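import Literature.Probability.Percolation.ZdFiveArmVertex
import Literature.Probability.Percolation.ZdFiveArmEnvironment
import Literature.Probability.Percolation.ZdFourArmSepInwardExt
import HarnessLib

/-!
# The five-arm lower bound for critical bond percolation on `ℤ²`, two radii: `c (m/n)² ≤ P(𝒜₅(A_{m,n}))`

Topic `Literature/Probability/Percolation`; bond percolation on `ℤ² = Site 2` at `p = 1/2`.
Final file of the bond-`ℤ²` rendering of Nolin's construction of a five-arm vertex (P. Nolin,
EJP 13 (2008), §5.2, proof of Thm. 24 (ii) [arXiv 0711.4948: Thm. 23 (ii), p. 17]: "condition on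
the lowest black left-right crossing `c` … any site on this crossing has already 3 arms … with
positive probability `c` is connected to the top side by a black path included in
`[-N/8,0] × [-N,N]`, and another white path included in `[0,N/8] × [-N,N]` … consider the last
vertex `v` before `v₂` that is connected to the top side: … there is a white arm from `v` to the
top side … `P(⋃_{v ∈ S_{N/2}} {v ⇝⁵ ∂S_N}) ≤ C' N² P(0 ⇝⁵ ∂S_N)`"; §8.1: "We can also handle bond
percolation in this way"; originally Kesten 1987; for the two-radii form at `q = 1` see
Duminil-Copin–Manolescu–Tassion 2021, Prop. 6.6, and Chelkak–Duminil-Copin–Hongler 2016, §5.2),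
assembling `ZdLowestFrontier.lean` (the lowest crossing), `ZdLowestFrontierFeet.lean` (the double
foot), `ZdFiveArmVertex.lean` (the five arms around a pivotal attached vertex),
`ZdFiveArmEnvironment.lean` (the environment and Nolin's conditioning) and `ZdFiveArmCounting.lean`
(the union bound with translation invariance):

* `exists_grid_relabel_mem_zdFiveArmClusters` — on the good event at scale `n`, some point of the
  grid `(2m-1)ℤ²` of the rectangle is the centre of `zdFiveArmClusters m n` (the two-radii form is
  obtained directly, by gridding at mesh `2m - 1` instead of quasi-multiplicativity);
* `le_real_fiveArmGood_scale` — the good event has probability `≥ c₁₆⁵` (RSW at aspect ratio 16);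
* `zdFiveArm_lowerBound_two_radii` — **`c (m/n)² ≤ P_{1/2}(zdFiveArmClusters m n)` for
  `1 ≤ m ≤ n`**, the input `h5` of
  `DuminilCopinManolescuTassion2021_zdFourArm_lowerBound_of_fiveArm_lowerBound`
  (`ZdFourArmQuasiMultProofs.lean`).

## References

* P. Nolin, *Near-critical percolation in two dimensions*, EJP 13 (2008), §5.2 Thm. 24 (ii) and
  its proof, §8.1 (arXiv 0711.4948: Thm. 23 (ii), p. 17) [Nolin2008].
* H. Kesten, *Scaling relations for 2D-percolation*, CMP 109 (1987), Lemma 2 [KestenScalingCMP1987].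
* H. Duminil-Copin, I. Manolescu, V. Tassion, PTRF 181 (2021), §6.3 Prop. 6.6
  [DuminilCopinManolescuTassion2021].
* B. Bollobás, O. Riordan, *Percolation* (2006), Ch. 3 eq. (3) (RSW) [BollobasRiordan2006].

## Tree

`fiveArmGood`, `le_real_fiveArmGood`, `le_real_fiveArmEnv`, `exists_isAttachedLow_of_attachCol`,
`exists_hasDualFootAt_of_dfootCol` (`ZdFiveArmEnvironment.lean`);
`relabel_shift_mem_zdFiveArmClusters_of_pivotal` (`ZdFiveArmVertex.lean`); `exists_doubleFoot`,
`mem_support_of_hasDualFootAt` (`ZdLowestFrontierFeet.lean`); `nonempty_lowPath`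
(`ZdLowestFrontier.lean`); `real_exists_shift_mem_zdFiveArmClusters_le` (`ZdFiveArmCounting.lean`);
`rsw_lowerBound_holds` (`RSWLemma.lean`).
-/

noncomputable section

open SimpleGraph Finset

namespace Literature.Probability.Percolation

open LatticeModels _root_.MeasureTheory

variable {ω : BondConfig (Site 2)}

/-! ### Rows of low vertices -/

/-- Under the height constraints of `fiveArmGood`, a low vertex has row in `[lo, hi + 1]`.
[folklore] -/
theorem row_bounds_of_isLowVertex {M N lo hi : ℕ} (hShi : ∀ g ∈ dualBelowR M N ω, g 1 < hi)
    (hAlo : ∀ f, IsAboveFace M N ω f → (lo : ℤ) ≤ f 1) {p : Site 2} (hp : IsLowVertex M N ω p) :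
    (lo : ℤ) ≤ p 1 ∧ p 1 ≤ hi + 1 := by
  obtain ⟨e, ⟨g, f, hgf, hg, hf, rfl⟩, hpe⟩ := hp
  have h1 := hShi g hg
  have h2 := hAlo f hf
  have h3 := (sepEdge_apply_le hpe).2
  have h4 : g 1 - 1 ≤ f 1 ∧ f 1 ≤ g 1 + 1 := by
    rcases stepKind_of_adj hgf with ⟨-, h⟩ | ⟨-, h⟩ | ⟨h, -⟩ | ⟨h, -⟩ <;> omega
  constructor
  · have : f 1 ≤ max (g 1) (f 1) := le_max_right _ _; omega
  · have : max (g 1) (f 1) ≤ g 1 + 1 := max_le (by omega) h4.2; omega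

/-! ### The grid of centres -/

/-- Rounding to the grid `(2m-1)ℤ`: the multiple of `2m - 1` nearest to `x` (ties impossible).
[folklore] -/
def gridRound (m : ℕ) (x : ℤ) : ℤ := (2 * (m : ℤ) - 1) * ((x + (m - 1)) / (2 * (m : ℤ) - 1))

/-- The rounding error is at most `m - 1`. [folklore] -/
theorem abs_sub_gridRound_le {m : ℕ} (hm : 1 ≤ m) (x : ℤ) :
    -((m : ℤ) - 1) ≤ x - gridRound m x ∧ x - gridRound m x ≤ (m : ℤ) - 1 := by
  have hpos : (0 : ℤ) < 2 * (m : ℤ) - 1 := by omega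
  have h1 := Int.mul_ediv_add_emod (x + (m - 1)) (2 * (m : ℤ) - 1)
  have h2 := Int.emod_nonneg (x + (m - 1)) hpos.ne'
  have h3 := Int.emod_lt_of_pos (x + (m - 1)) hpos
  rw [gridRound]
  constructor <;> omega

/-- The grid multiple is between `-1` and `x / (2m-1) + 1` times `2m - 1` for `0 ≤ x`; we only need
the index bounds. [folklore] -/
theorem gridIndex_bounds {m : ℕ} (hm : 1 ≤ m) {x B : ℤ} (hx0 : 0 ≤ x) (hxB : x ≤ B) :
    0 ≤ (x + (m - 1)) / (2 * (m : ℤ) - 1) ∧ (x + (m - 1)) / (2 * (m : ℤ) - 1) ≤ B / (2 * (m : ℤ) - 1) + 1 := by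
  have hpos : (0 : ℤ) < 2 * (m : ℤ) - 1 := by omega
  refine ⟨Int.ediv_nonneg (by omega) hpos.le, ?_⟩
  have : x + (m - 1) ≤ B + (2 * (m : ℤ) - 1) := by omega
  calc (x + (m - 1)) / (2 * (m : ℤ) - 1) ≤ (B + (2 * (m : ℤ) - 1)) / (2 * (m : ℤ) - 1) := Int.ediv_le_ediv hpos this
    _ = B / (2 * (m : ℤ) - 1) + 1 := by rw [Int.add_ediv_of_dvd_right (dvd_refl _), Int.ediv_self hpos.ne']

/-- **The grid of centres** for the rectangle `[0, M] × [0, N']`: the points of `(2m-1)ℤ²` with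
indices in `[0, M/(2m-1) + 1] × [0, N'/(2m-1) + 1]`. [folklore] -/
def fiveArmGrid (m M N' : ℕ) : Finset (Site 2) :=
  (Finset.Icc (0 : ℤ) ((M : ℤ) / (2 * (m : ℤ) - 1) + 1) ×ˢ Finset.Icc (0 : ℤ) ((N' : ℤ) / (2 * (m : ℤ) - 1) + 1)).image
    fun q => ![(2 * (m : ℤ) - 1) * q.1, (2 * (m : ℤ) - 1) * q.2]

/-- The grid point nearest to a point of the rectangle belongs to the grid. [folklore] -/
theorem gridRound_mem_fiveArmGrid {m M N' : ℕ} (hm : 1 ≤ m) {p : Site 2} (hp0 : 0 ≤ p 0) (hpM : p 0 ≤ M)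
    (hp1 : 0 ≤ p 1) (hpN : p 1 ≤ N') :
    (![gridRound m (p 0), gridRound m (p 1)] : Site 2) ∈ fiveArmGrid m M N' := by
  rw [fiveArmGrid, Finset.mem_image]
  refine ⟨((p 0 + (m - 1)) / (2 * (m : ℤ) - 1), (p 1 + (m - 1)) / (2 * (m : ℤ) - 1)),
    Finset.mem_product.2 ⟨Finset.mem_Icc.2 (gridIndex_bounds hm hp0 hpM), Finset.mem_Icc.2 (gridIndex_bounds hm hp1 hpN)⟩, rfl⟩

/-- **Cardinality of the grid**: `|grid| ≤ (M/(2m-1) + 2) (N'/(2m-1) + 2)`. [folklore] -/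
theorem card_fiveArmGrid_le (m M N' : ℕ) (hm : 1 ≤ m) :
    ((fiveArmGrid m M N').card : ℝ) ≤ ((M : ℝ) / (2 * m - 1) + 2) * ((N' : ℝ) / (2 * m - 1) + 2) := by
  have hpos : (0 : ℤ) < 2 * (m : ℤ) - 1 := by omega
  have hposR : (0 : ℝ) < 2 * (m : ℝ) - 1 := by
    have : (1 : ℝ) ≤ m := by exact_mod_cast hm
    linarith
  have hcard : (fiveArmGrid m M N').card ≤
      (Finset.Icc (0 : ℤ) ((M : ℤ) / (2 * (m : ℤ) - 1) + 1)).card * (Finset.Icc (0 : ℤ) ((N' : ℤ) / (2 * (m : ℤ) - 1) + 1)).card := by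
    rw [fiveArmGrid, ← Finset.card_product]
    exact Finset.card_image_le
  have hI : ∀ B : ℕ, ((Finset.Icc (0 : ℤ) ((B : ℤ) / (2 * (m : ℤ) - 1) + 1)).card : ℝ) ≤ (B : ℝ) / (2 * m - 1) + 2 := by
    intro B
    have hq0 : 0 ≤ (B : ℤ) / (2 * (m : ℤ) - 1) := Int.ediv_nonneg (by positivity) hpos.le
    set q : ℤ := (B : ℤ) / (2 * (m : ℤ) - 1) with hq
    rw [Int.card_Icc]
    have hnat : (((q + 1 + 1 - 0).toNat : ℕ) : ℤ) = q + 2 := by rw [Int.toNat_of_nonneg (by omega)]; ring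
    have hnatR : (((q + 1 + 1 - 0).toNat : ℕ) : ℝ) = (q : ℝ) + 2 := by
      have := congrArg (fun z : ℤ => (z : ℝ)) hnat
      push_cast at this ⊢
      linarith
    have hle : (2 * (m : ℤ) - 1) * q ≤ B := Int.mul_ediv_self_le (by omega)
    have hleR : (2 * (m : ℝ) - 1) * (q : ℝ) ≤ B := by exact_mod_cast hle
    have hdiv : (q : ℝ) ≤ (B : ℝ) / (2 * m - 1) := by
      rw [le_div_iff₀ hposR]; linarith
    rw [hnatR]
    linarith
  calc ((fiveArmGrid m M N').card : ℝ)
      ≤ ((Finset.Icc (0 : ℤ) ((M : ℤ) / (2 * (m : ℤ) - 1) + 1)).card : ℝ) *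
          ((Finset.Icc (0 : ℤ) ((N' : ℤ) / (2 * (m : ℤ) - 1) + 1)).card : ℝ) := by exact_mod_cast hcard
    _ ≤ ((M : ℝ) / (2 * m - 1) + 2) * ((N' : ℝ) / (2 * m - 1) + 2) :=
        mul_le_mul (hI M) (hI N') (by positivity) (by positivity)

/-! ### The five-arm event around a grid point, on the good event -/

/-- Membership of `π l` in the two halves of `π` at `k`. [folklore] -/
theorem getVert_mem_support_take {V : Type*} {G : SimpleGraph V} {a b : V} (π : G.Walk a b) {l k : ℕ} (h : l ≤ k) :
    π.getVert l ∈ (π.take k).support := by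
  have := (π.take k).getVert_mem_support l
  rwa [Walk.take_getVert, min_eq_right h] at this

/-- Membership of `π l` in the two halves of `π` at `k`. [folklore] -/
theorem getVert_mem_support_drop {V : Type*} {G : SimpleGraph V} {a b : V} (π : G.Walk a b) {l k : ℕ} (h : k ≤ l) :
    π.getVert l ∈ (π.drop k).support := by
  have := (π.drop k).getVert_mem_support (l - k)
  rwa [Walk.drop_getVert, Nat.add_sub_cancel' h] at this

/-- **On the good event, some grid point is the centre of the five-arm annulus event** (Nolin's
construction assembled: lowest crossing `ZdLowestFrontier`, double foot `exists_doubleFoot`,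
pivotality `mem_support_of_hasDualFootAt`, arms `relabel_shift_mem_zdFiveArmClusters_of_pivotal`),
for the scale `n`, the inner radius `1 ≤ m ≤ n`, the rectangle `[0, 10n+1] × [0, 6n+2]`, heights
`[2n, 4n+1]`, columns `[4n, 5n]` and `[5n+1, 6n+2]`, and the grid `(2m-1)ℤ²`. [cite: Nolin2008, §5.2, proof of Thm. 24 (ii) (arXiv 0711.4948: Thm. 23 (ii), p. 17)] -/
theorem exists_grid_relabel_mem_zdFiveArmClusters {m n : ℕ} (hω : ω ⊆ (zdGraph 2).edgeSet) (hm : 1 ≤ m) (hmn : m ≤ n)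
    (hG : ω ∈ fiveArmGood (10 * n + 1) (6 * n + 2) (2 * n) (4 * n + 1) (4 * n) (5 * n) (5 * n + 1) (6 * n + 1)) :
    ∃ v ∈ fiveArmGrid m (10 * n + 1) (6 * n + 2),
      BondConfig.relabel (sym2Equiv (Site.shift (-v))) ω ∈ zdFiveArmClusters m n := by
  classical
  have hn : 1 ≤ n := le_trans hm hmn
  have hM1 : 1 ≤ 10 * n + 1 := by omega
  obtain ⟨hT, hShi, hAlo, hA, hD⟩ := hG
  obtain ⟨Λ⟩ := nonempty_lowPath hM1 hT
  -- attachment and dual foot in the columns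
  have hSrow : ∀ g ∈ dualBelowR (10 * n + 1) (6 * n + 2) ω, g 1 + 1 < ((6 * n + 2 : ℕ) : ℤ) := fun g hg => by
    have := hShi g hg; push_cast at this ⊢; omega
  obtain ⟨i, hi, hiA, hi1, hi2⟩ := exists_isAttachedLow_of_attachCol hM1 hT hSrow Λ hA
  obtain ⟨j, hj, hjD, hj1, hj2⟩ := exists_hasDualFootAt_of_dfootCol hω Λ hD
  -- the double foot
  have hends : (Λ.a 0 = 0 ∧ Λ.b 0 = ((10 * n + 1 : ℕ) : ℤ)) ∨ (Λ.a 0 = ((10 * n + 1 : ℕ) : ℤ) ∧ Λ.b 0 = 0) :=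
    Or.inl ⟨Λ.left, Λ.right⟩
  obtain ⟨k, hk1, hk2, hkA, hkD⟩ := exists_doubleFoot hω hM1 hT Λ.path Λ.isPath hends Λ.mem_rectangle
    Λ.mem_edges_iff hi hj hiA hjD
  have hkL : k ≤ Λ.path.length := le_trans hk2 (max_le hi hj)
  set p := Λ.path.getVert k with hp
  have hpRect := Λ.mem_rectangle p (Λ.path.getVert_mem_support k)
  have hpR := mem_rectangle_iff.1 hpRect
  have hplow : IsLowVertex (10 * n + 1) (6 * n + 2) ω p := (Λ.mem_support_iff hM1).1 (Λ.path.getVert_mem_support k)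
  have hprow := row_bounds_of_isLowVertex hShi hAlo hplow
  -- pivotality
  have hpiv : ∀ {a' b' : Site 2} (P : (zdGraph 2).Walk a' b'), (∀ z ∈ P.support, z ∈ rectangle (10 * n + 1) (6 * n + 2)) →
      ((a' 0 = 0 ∧ b' 0 = ((10 * n + 1 : ℕ) : ℤ)) ∨ (a' 0 = ((10 * n + 1 : ℕ) : ℤ) ∧ b' 0 = 0)) →
      (∀ e ∈ P.edges, e ∈ ω) → Λ.path.getVert k ∈ P.support :=
    fun P hPs hPe hPω => mem_support_of_hasDualFootAt P hPs hPe hPω hplow hpRect hkD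
  -- the centre
  have hpk : ∀ i', Λ.path.getVert k i' = p i' := fun _ => rfl
  have hvG : (![gridRound m (p 0), gridRound m (p 1)] : Site 2) ∈ fiveArmGrid m (10 * n + 1) (6 * n + 2) :=
    gridRound_mem_fiveArmGrid hm hpR.1 hpR.2.1 hpR.2.2.1 hpR.2.2.2
  generalize hvdef : (![gridRound m (p 0), gridRound m (p 1)] : Site 2) = v at hvG
  have hv0' : v 0 = gridRound m (p 0) := by rw [← hvdef]; simp
  have hv1' : v 1 = gridRound m (p 1) := by rw [← hvdef]; simp
  have hv0 := abs_sub_gridRound_le hm (p 0)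
  have hv1 := abs_sub_gridRound_le hm (p 1)
  have hfar : ∀ {z : Site 2}, (n : ℤ) < z 0 - v 0 ∨ (n : ℤ) < v 0 - z 0 → z - v ∉ box 2 n := by
    intro z hz h
    have := (mem_box.1 h) 0
    simp only [Pi.sub_apply] at this
    omega
  -- x-coordinates of the column vertices
  have hcolx : ∀ l, (l = i ∨ l = j) → 4 * (n : ℤ) ≤ Λ.path.getVert l 0 ∧ Λ.path.getVert l 0 ≤ 6 * n + 2 := by
    rintro l (rfl | rfl)
    · constructor <;> omega
    · constructor <;> omega
  have hmaxij : max i j = i ∨ max i j = j := by rcases le_total i j with h | h <;> simp [h]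
  have hminij : min i j = i ∨ min i j = j := by rcases le_total i j with h | h <;> simp [h]
  refine ⟨v, hvG, relabel_shift_mem_zdFiveArmClusters_of_pivotal hω Λ.path Λ.isPath hends Λ.mem_rectangle
    Λ.mem_edges_iff hkL hkA hpiv hm hmn (by push_cast; omega) ?_ ?_ ?_ ?_ ?_⟩
  · -- the hole contains `p`
    rw [mem_box]; intro i'
    have h0 := hpk 0; have h1 := hpk 1
    fin_cases i' <;> simp only [Pi.sub_apply, Fin.zero_eta, Fin.isValue, Fin.mk_one] <;> omega
  · -- the right half leaves `v + Λ_n`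
    by_cases hc : (n : ℤ) < v 0 ∧ v 0 + n < ((10 * n + 1 : ℕ) : ℤ)
    · refine ⟨Λ.b, Walk.end_mem_support _, hfar (Or.inl ?_)⟩
      rw [Λ.right]; omega
    · refine ⟨Λ.path.getVert (max i j), getVert_mem_support_drop Λ.path hk2, hfar ?_⟩
      have := hcolx (max i j) hmaxij
      push Not at hc
      omega
  · -- the left half leaves `v + Λ_n`
    by_cases hc : (n : ℤ) < v 0 ∧ v 0 + n < ((10 * n + 1 : ℕ) : ℤ)
    · refine ⟨Λ.a, Walk.start_mem_support _, hfar (Or.inr ?_)⟩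
      rw [Λ.left]; omega
    · refine ⟨Λ.path.getVert (min i j), getVert_mem_support_take Λ.path hk1, hfar ?_⟩
      have := hcolx (min i j) hminij
      push Not at hc
      omega
  · omega
  · omega

/-! ### The five-arm lower bound -/

/-- RSW lower bound for the dual-foot column crossing (aspect ratio `≤ k`). [cite: BollobasRiordan2006, Ch. 3, eq. (3) and Cor. 3(i)] -/
theorem ZdFiveArmLB.le_real_dualFaceCrossing_of_rsw_ratio {k : ℕ} {c : ℝ}
    (hc : ∀ l : ℕ, 1 ≤ l → c ≤ crossingProb half (k * l - 1) (l - 1)) (u : Site 2) {w n' : ℕ} (hw : 1 ≤ w)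
    (hn : n' + 1 ≤ k * w - 1) : c ≤ (bondPercolation (zdGraph 2) half).real (dualFaceCrossing u w n') := by
  have := crossingProb_le_real_dualFaceCrossing u (w - 1) n'
  rw [Nat.sub_add_cancel hw] at this
  refine le_trans ?_ this
  exact (hc w hw).trans (crossingProb_anti_left half hn _)

/-- **The probability of the good event is bounded below** uniformly in the scale:
`c₁₆⁵ ≤ P(fiveArmGood (10n+1) (6n+2) (2n) (4n+1) (4n) (5n) (5n+1) (6n+1))` with the RSW constant
of aspect ratio `16`. [cite: Nolin2008, §5.2, proof of Thm. 24 (ii) (arXiv 0711.4948: Thm. 23 (ii), p. 17)] -/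
theorem le_real_fiveArmGood_scale {c : ℝ} (hc0 : 0 < c)
    (hc : ∀ l : ℕ, 1 ≤ l → c ≤ crossingProb half (16 * l - 1) (l - 1)) {n : ℕ} (hn : 1 ≤ n) :
    c ^ 5 ≤ (bondPercolation (zdGraph 2) half).real
      (fiveArmGood (10 * n + 1) (6 * n + 2) (2 * n) (4 * n + 1) (4 * n) (5 * n) (5 * n + 1) (6 * n + 1)) := by
  have hM1 : 1 ≤ 10 * n + 1 := by omega
  have hEnv : c * c * c ≤ (bondPercolation (zdGraph 2) half).real (fiveArmEnv (10 * n + 1) (2 * n) (n - 1) (3 * n + 2) (n - 1)) :=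
    le_real_fiveArmEnv (k := 16) hc0.le hc hM1 (by omega) (by omega) (by omega) (by omega)
  have hA : c ≤ (bondPercolation (zdGraph 2) half).real (tbCrossingAt' ![((4 * n : ℕ) : ℤ), 0] n (6 * n + 2)) :=
    le_real_tbCrossingAt'_of_rsw_ratio (k := 16) hc _ (by omega)
  have hDf : c ≤ (bondPercolation (zdGraph 2) half).real (dualFaceCrossing ![((5 * n + 1 : ℕ) : ℤ), 0] n (6 * n + 2)) :=
    ZdFiveArmLB.le_real_dualFaceCrossing_of_rsw_ratio (k := 16) hc _ hn (by omega)
  have hGood := le_real_fiveArmGood (M := 10 * n + 1) (N := 6 * n + 2) hM1 (lo := 2 * n) (H := n - 1) (h' := 3 * n + 2)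
    (H' := n - 1) (by omega) (by omega) (a₁ := ((4 * n : ℕ) : ℤ)) (a₂ := ((5 * n + 1 : ℕ) : ℤ)) (w₁ := n) (w₂ := n)
    (by positivity) (by push_cast; omega) (by push_cast; omega)
  have h1 : 3 * n + 2 + (n - 1) = 4 * n + 1 := by omega
  have h2 : ((4 * n : ℕ) : ℤ) + (n : ℕ) = ((5 * n : ℕ) : ℤ) := by push_cast; ring
  have h3 : ((5 * n + 1 : ℕ) : ℤ) + (n : ℕ) = ((6 * n + 1 : ℕ) : ℤ) := by push_cast; ring
  rw [h1, h2, h3] at hGood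
  push_cast at hGood ⊢
  calc c ^ 5 = c * c * (c * c * c) := by ring
    _ ≤ (bondPercolation (zdGraph 2) half).real (tbCrossingAt' ![4 * (n : ℤ), 0] n (6 * n + 2)) *
          (bondPercolation (zdGraph 2) half).real (dualFaceCrossing ![5 * (n : ℤ) + 1, 0] n (6 * n + 2)) *
          (bondPercolation (zdGraph 2) half).real (fiveArmEnv (10 * n + 1) (2 * n) (n - 1) (3 * n + 2) (n - 1)) :=
        mul_le_mul (mul_le_mul hA hDf hc0.le measureReal_nonneg) hEnv (by positivity) (by positivity)
    _ ≤ _ := hGood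

/-- **The grid is not too large**: `|grid| ≤ 130 (n/m)²` for `1 ≤ m ≤ n`. [folklore] -/
theorem card_fiveArmGrid_scale_le {m n : ℕ} (hm : 1 ≤ m) (hmn : m ≤ n) :
    ((fiveArmGrid m (10 * n + 1) (6 * n + 2)).card : ℝ) ≤ 130 * ((n : ℝ) / m) ^ 2 := by
  have hmR : (1 : ℝ) ≤ m := by exact_mod_cast hm
  have hmnR : (m : ℝ) ≤ n := by exact_mod_cast hmn
  have hm0 : (0 : ℝ) < m := by linarith
  have h2m : (m : ℝ) ≤ 2 * m - 1 := by linarith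
  have h2m0 : (0 : ℝ) < 2 * m - 1 := by linarith
  have hq : 1 ≤ (n : ℝ) / m := by rw [le_div_iff₀ hm0]; linarith
  refine (card_fiveArmGrid_le m (10 * n + 1) (6 * n + 2) hm).trans ?_
  have hn1 : (1 : ℝ) ≤ n := le_trans hmR hmnR
  have hA : ((10 * n + 1 : ℕ) : ℝ) / (2 * m - 1) + 2 ≤ 13 * ((n : ℝ) / m) := by
    have h1 : ((10 * n + 1 : ℕ) : ℝ) / (2 * m - 1) ≤ ((10 * n + 1 : ℕ) : ℝ) / m :=
      div_le_div_of_nonneg_left (by positivity) hm0 h2m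
    have h2 : ((10 * n + 1 : ℕ) : ℝ) / m ≤ 11 * ((n : ℝ) / m) := by
      rw [← mul_div_assoc]
      exact div_le_div_of_nonneg_right (by push_cast; linarith) hm0.le
    linarith
  have hB : ((6 * n + 2 : ℕ) : ℝ) / (2 * m - 1) + 2 ≤ 10 * ((n : ℝ) / m) := by
    have h1 : ((6 * n + 2 : ℕ) : ℝ) / (2 * m - 1) ≤ ((6 * n + 2 : ℕ) : ℝ) / m :=
      div_le_div_of_nonneg_left (by positivity) hm0 h2m
    have h2 : ((6 * n + 2 : ℕ) : ℝ) / m ≤ 8 * ((n : ℝ) / m) := by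
      rw [← mul_div_assoc]
      exact div_le_div_of_nonneg_right (by push_cast; linarith) hm0.le
    linarith
  calc (((10 * n + 1 : ℕ) : ℝ) / (2 * m - 1) + 2) * (((6 * n + 2 : ℕ) : ℝ) / (2 * m - 1) + 2)
      ≤ (13 * ((n : ℝ) / m)) * (10 * ((n : ℝ) / m)) := mul_le_mul hA hB (by positivity) (by positivity)
    _ = 130 * ((n : ℝ) / m) ^ 2 := by ring

/-- **The five-arm exponent of critical bond percolation on `ℤ²` is at most `2`, two radii**
(Nolin 2008, Thm. 24 (ii) for the point version on site-`𝕋`, §8.1 for bond-`ℤ²`;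
Chelkak–Duminil-Copin–Hongler 2016, §5.2; Duminil-Copin–Manolescu–Tassion 2021, Prop. 6.6, lower
bound at `q = 1`): there is `c > 0` with `c (m/n)² ≤ P_{1/2}(𝒜₅(A_{m,n}))` for all `1 ≤ m ≤ n`, in
the cluster form `zdFiveArmClusters`.  Proof: the good event has probability `≥ c₁₆⁵`
(`le_real_fiveArmGood_scale`), on it some point of a grid of `≤ 130 (n/m)²` centres is the centre
of the five-arm event (`exists_grid_relabel_mem_zdFiveArmClusters`), and the union bound with
translation invariance (`real_exists_shift_mem_zdFiveArmClusters_le`) concludes. [cite: Nolin2008, §5.2, Thm. 24 (ii) and its proof, §8.1 (arXiv 0711.4948: Thm. 23 (ii), p. 17)] -/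
theorem zdFiveArm_lowerBound_two_radii :
    ∃ c : ℝ, 0 < c ∧ ∀ m n : ℕ, 1 ≤ m → m ≤ n →
      c * ((m : ℝ) / n) ^ 2 ≤ (bondPercolation (zdGraph 2) half).real (zdFiveArmClusters m n) := by
  obtain ⟨c, hc0, hc⟩ := rsw_lowerBound_holds 16 (by norm_num)
  refine ⟨c ^ 5 / 130, by positivity, fun m n hm hmn => ?_⟩
  have hn : 1 ≤ n := le_trans hm hmn
  set μ := bondPercolation (zdGraph 2) half with hμ
  have hGood := le_real_fiveArmGood_scale hc0 hc hn
  have hcover : μ.real (fiveArmGood (10 * n + 1) (6 * n + 2) (2 * n) (4 * n + 1) (4 * n) (5 * n) (5 * n + 1) (6 * n + 1)) ≤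
      μ.real {ω | ∃ v ∈ fiveArmGrid m (10 * n + 1) (6 * n + 2),
        BondConfig.relabel (sym2Equiv (Site.shift (-v))) ω ∈ zdFiveArmClusters m ((fun _ : Site 2 => n) v)} :=
    real_le_real_of_subset_lattice half fun ω hω hG => exists_grid_relabel_mem_zdFiveArmClusters hω hm hmn hG
  have hcount := real_exists_shift_mem_zdFiveArmClusters_le half (fiveArmGrid m (10 * n + 1) (6 * n + 2)) hmn
    (fun _ => n) (fun _ _ => le_rfl)
  have hcard := card_fiveArmGrid_scale_le hm hmn
  have key : c ^ 5 ≤ 130 * ((n : ℝ) / m) ^ 2 * μ.real (zdFiveArmClusters m n) :=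
    hGood.trans (hcover.trans (hcount.trans (mul_le_mul_of_nonneg_right hcard measureReal_nonneg)))
  have hm0 : (0 : ℝ) < m := by exact_mod_cast hm
  have hn0 : (0 : ℝ) < n := by exact_mod_cast hn
  have hnm : ((n : ℝ) / m) ^ 2 * ((m : ℝ) / n) ^ 2 = 1 := by field_simp
  calc c ^ 5 / 130 * ((m : ℝ) / n) ^ 2
      ≤ (130 * ((n : ℝ) / m) ^ 2 * μ.real (zdFiveArmClusters m n)) / 130 * ((m : ℝ) / n) ^ 2 := by gcongr
    _ = μ.real (zdFiveArmClusters m n) * (((n : ℝ) / m) ^ 2 * ((m : ℝ) / n) ^ 2) := by ring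
    _ = μ.real (zdFiveArmClusters m n) := by rw [hnm, mul_one]

/-- The form with a threshold ratio `A = 1`, consumed by
`DuminilCopinManolescuTassion2021_zdFourArm_lowerBound_of_fiveArm_lowerBound`. [folklore] -/
theorem zdFiveArm_lowerBound_two_radii' :
    ∃ c : ℝ, 0 < c ∧ ∀ r R : ℕ, 1 ≤ r → 1 * r ≤ R →
      c * ((r : ℝ) / R) ^ 2 ≤ (bondPercolation (zdGraph 2) half).real (zdFiveArmClusters r R) := by
  obtain ⟨c, hc, h⟩ := zdFiveArm_lowerBound_two_radii
  exact ⟨c, hc, fun r R hr hrR => h r R hr (by omega)⟩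

end Literature.Probability.Percolation

end
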